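import Literature.Probability.Percolation.MarkedLoopTripodBasis
import Literature.Probability.Percolation.MarkedLoopRotation
import HarnessLib

/-!
# The tripod law at five marks, solved explicitly («TRIPOD-SOLVED-FIVE»)

Topic `Literature/Probability/Percolation`; generic-`k` layer of the three-disorder lineage (Khristoforov–Smirnov 2021) at `k = 5`, a rider on
`MarkedLoopTripodBasis.lean` (TRIPOD-SOLVED, every `k`: patterns `Pat k`, outermost patterns `Pat₀ k`, the solution space `solW k` of the
tripod law with `finrank_solW : finrank = #Pat₀ k` and `finrank_solW_eq_card_ncMatching : = #NCMatching (k+1)`, the fan member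
`restrictW_fanWt_mem_solW`, `tripodLaw_iff_restrict_mem_solW`) and on `MarkedLoopRotation.lean` (ROT: `rotW`, `tripodLaw_rotW_fanWt` — the
`k` rotated fans obey the law). The generic file leaves the COUNT of outermost patterns / link patterns symbolic («the Catalan VALUE is not
evaluated»). This file evaluates everything at FIVE marks:

* `§ PatternsFive` — ★ `relation_five`: a pattern `(j; L)` on five corners has `L ∈ {adjRel₅ j, nestRel₅ j}` (adjacent pairs
  `{j+1~j+2, j+3~j+4}` or nested pairs `{j+1~j+4, j+2~j+3}`; the third matching crosses); `depth_five`; ★★ `pat₀_five` — THE OUTERMOST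
  PATTERNS ARE EXACTLY FIVE: `(0; adj), (0; nest), (2; adj), (4; adj), (4; nest)` (`outer₅`, injective); ★★ `card_pat₀_five : #Pat₀ 5 = 5`,
  ★★★ `finrank_solW_five : finrank ℂ (solW 5) = 5`, ★ `card_ncMatching_six : #NCMatching 6 = 5` (the Catalan number `C₃`, in the kernel).
* `§ FanBasis` — `fanR s` = the `s`-th rotated fan restricted to patterns (`fanR_mem_solW`); ★ `fanR_nestPat₅`: on the nested patterns
  `(j; nestRel₅ j)` the rotated fans evaluate to the two-diagonal circulant `−[j+s = 0] − τ⁴[j+s = 2]`; ★★ `linearIndependent_fanR` (a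
  vanishing combination has coefficients with `g(t) + τ⁴ g(t+2) = 0` around `ℤ/5`, and `τ^20 + 1 = −τ ≠ 0`); ★★★ `fanBasis : Module.Basis (Fin 5) ℂ (solW 5)`
  — THE FIVE ROTATED FANS ARE A BASIS; `eq_sum_fanR_of_mem_solW`; ★★★ `tripodLaw_five_iff_exists_sum_fanR` — a five-disorder class weight
  obeys the tripod law iff, on the patterns, it is a (unique) linear combination of the five rotated fans.

With the lane's «TRIPOD-NECESSITY-FIVE» (`MarkedLoopNecessityFive`: tripod law ⟺ discrete holomorphicity on every five-marked domain) this
classifies the discretely holomorphic five-disorder pattern observables: a five-dimensional space spanned by the rotations of the fan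
(consistency remark only; that file is not imported here).

The statements are the lane's (Khristoforov–Smirnov treat three disorders; the five-mark evaluation is not in print).

## References
* M. Khristoforov, S. Smirnov, *Percolation and O(1) loop model*, arXiv:2111.15612 (2021), §1.2 (arXiv v1 pp. 2–3: link patterns, «IP(ξ) is a
  union of disjoint paths, matching marked points», cyclic indexing), §2 Definition 3 and Lemma 4 with its proof and Fig. 3 (p. 4), Remark 6 (p. 5).
* B. Bollobás, O. Riordan, *Percolation*, Cambridge University Press (2006), Ch. 7 §7.2.2 (pp. 191–195: marked discrete domains).

## Mathlib / tree
Tree: `MarkedLoopTripodBasis.lean` (`IsPattern` with `off₂`, `ne_of_mem`, `partner_eq`; `Pat`, `Pat₀`, `Pat.pdepth`, `depth`, `solW`,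
`finrank_solW`, `card_pat₀_eq_card_ncMatching`, `NCMatching`, `restrictW`, `tripodLaw_iff_restrict_mem_solW`, `fanRel`), `MarkedLoopRotation.lean`
(`rot`, `val_rot_pow`, `relMap`, `rotW`, `tripodLaw_rotW_fanWt`), `MarkedLoopHolomorphy.lean` (`fanWt`, `CcwQuad`, `TripodLaw`). Mathlib:
`Fintype.card_congr`, `Equiv.ofBijective`, `Fintype.linearIndependent_iff`, `Fintype.sum_eq_add`, `basisOfLinearIndependentOfCardEqFinrank`,
`Module.Basis.sum_repr`, `IsPrimitiveRoot.geom_sum_eq_zero`, `decide`.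
-/

open Finset

namespace Literature.Probability.Percolation.MarkedLoops

open Literature.Probability.Percolation.FivePoint (tau)

/-! ### The patterns of five corners -/
section PatternsFive

/-- the relation «adjacent pairs» seen from `j`: `{j+1 ~ j+2, j+3 ~ j+4}`. [cite: KhristoforovSmirnov2021, §1.2 (arXiv v1 p. 2: the link pattern)] -/
def adjRel₅ (j : Fin 5) : Finset (Fin 5 × Fin 5) := {(j + 1, j + 2), (j + 2, j + 1), (j + 3, j + 4), (j + 4, j + 3)}

/-- the relation «nested pairs» seen from `j`: `{j+1 ~ j+4, j+2 ~ j+3}`. [cite: KhristoforovSmirnov2021, §1.2 (arXiv v1 p. 2: the link pattern)] -/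
def nestRel₅ (j : Fin 5) : Finset (Fin 5 × Fin 5) := {(j + 1, j + 4), (j + 4, j + 1), (j + 2, j + 3), (j + 3, j + 2)}

/-- membership in `adjRel₅`. [folklore] -/
private theorem mem_adjRel₅ {j x y : Fin 5} :
    (x, y) ∈ adjRel₅ j ↔ x = j + 1 ∧ y = j + 2 ∨ x = j + 2 ∧ y = j + 1 ∨ x = j + 3 ∧ y = j + 4 ∨ x = j + 4 ∧ y = j + 3 := by
  unfold adjRel₅
  simp only [Finset.mem_insert, Finset.mem_singleton, Prod.mk.injEq]

/-- membership in `nestRel₅`. [folklore] -/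
private theorem mem_nestRel₅ {j x y : Fin 5} :
    (x, y) ∈ nestRel₅ j ↔ x = j + 1 ∧ y = j + 4 ∨ x = j + 4 ∧ y = j + 1 ∨ x = j + 2 ∧ y = j + 3 ∨ x = j + 3 ∧ y = j + 2 := by
  unfold nestRel₅
  simp only [Finset.mem_insert, Finset.mem_singleton, Prod.mk.injEq]

/-- `(j; adjacent pairs)` is a pattern. [cite: KhristoforovSmirnov2021, §1.2 (arXiv v1 p. 2)] -/
theorem isPattern_adjRel₅ (j : Fin 5) : IsPattern j (adjRel₅ j) := by
  have hs : ∀ j a b : Fin 5, (a, b) ∈ adjRel₅ j → (b, a) ∈ adjRel₅ j := by decide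
  have hi : ∀ j a : Fin 5, (a, a) ∉ adjRel₅ j := by decide
  have ho : ∀ j a b : Fin 5, (a, b) ∈ adjRel₅ j → a ≠ j := by decide
  have hp : ∀ j a : Fin 5, a ≠ j → ∃ b, (a, b) ∈ adjRel₅ j ∧ ∀ b', (a, b') ∈ adjRel₅ j → b' = b := by decide
  have hq : ∀ j x y z w : Fin 5, (x, z) ∈ adjRel₅ j → (y, w) ∈ adjRel₅ j → ¬ CcwQuad x y z w := by unfold CcwQuad; decide
  exact ⟨hs j, hi j, ho j, fun a ha => by obtain ⟨b, hb, hu⟩ := hp j a ha; exact ⟨b, hb, hu⟩, hq j⟩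

/-- `(j; nested pairs)` is a pattern. [cite: KhristoforovSmirnov2021, §1.2 (arXiv v1 p. 2)] -/
theorem isPattern_nestRel₅ (j : Fin 5) : IsPattern j (nestRel₅ j) := by
  have hs : ∀ j a b : Fin 5, (a, b) ∈ nestRel₅ j → (b, a) ∈ nestRel₅ j := by decide
  have hi : ∀ j a : Fin 5, (a, a) ∉ nestRel₅ j := by decide
  have ho : ∀ j a b : Fin 5, (a, b) ∈ nestRel₅ j → a ≠ j := by decide
  have hp : ∀ j a : Fin 5, a ≠ j → ∃ b, (a, b) ∈ nestRel₅ j ∧ ∀ b', (a, b') ∈ nestRel₅ j → b' = b := by decide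
  have hq : ∀ j x y z w : Fin 5, (x, z) ∈ nestRel₅ j → (y, w) ∈ nestRel₅ j → ¬ CcwQuad x y z w := by unfold CcwQuad; decide
  exact ⟨hs j, hi j, ho j, fun a ha => by obtain ⟨b, hb, hu⟩ := hp j a ha; exact ⟨b, hb, hu⟩, hq j⟩

/-- ★ **THE PATTERNS OF FIVE CORNERS**: the relation of a pattern with partner `j` is either the adjacent pairs or the nested pairs seen from `j`
(the third perfect matching of the four other corners crosses). [cite: KhristoforovSmirnov2021, §1.2 (arXiv v1 pp. 2–3: «disjoint paths, matching marked points»)] -/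
theorem relation_five {j : Fin 5} {L : Finset (Fin 5 × Fin 5)} (hP : IsPattern j L) : L = adjRel₅ j ∨ L = nestRel₅ j := by
  -- the partner `b` of `j+1`
  have h1 : ∀ j : Fin 5, j + 1 ≠ j := by decide
  obtain ⟨b, hb, -⟩ := hP.perfect (j + 1) (h1 j)
  have hbj : b ≠ j := hP.off₂ hb
  have hb1 : b ≠ j + 1 := fun e => hP.ne_of_mem hb e.symm
  have hcases : ∀ j b : Fin 5, b ≠ j → b ≠ j + 1 → b = j + 2 ∨ b = j + 3 ∨ b = j + 4 := by decide
  -- the generic "completion" step: if `j+1 ~ j+2` then `j+3 ~ j+4`; if `j+1 ~ j+4` then `j+2 ~ j+3`; `j+1 ~ j+3` crosses.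
  have others : ∀ j x : Fin 5, x ≠ j → x = j + 1 ∨ x = j + 2 ∨ x = j + 3 ∨ x = j + 4 := by decide
  have hquad : ∀ j : Fin 5, CcwQuad (j + 1) (j + 2) (j + 3) (j + 4) := by unfold CcwQuad; decide
  have hne : ∀ j : Fin 5, j + 2 ≠ j ∧ j + 3 ≠ j ∧ j + 4 ≠ j ∧ j + 1 ≠ j + 2 ∧ j + 1 ≠ j + 3 ∧ j + 1 ≠ j + 4 ∧ j + 2 ≠ j + 3 ∧
      j + 2 ≠ j + 4 ∧ j + 3 ≠ j + 4 := by decide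
  obtain ⟨n2, n3, n4, n12, n13, n14, n23, n24, n34⟩ := hne j
  have huniq : ∀ {a c d : Fin 5}, (a, c) ∈ L → (a, d) ∈ L → c = d := fun hc hd => hP.partner_eq hc hd
  have hb' := hP.symm _ _ hb
  rcases hcases j b hbj hb1 with rfl | rfl | rfl
  · -- `j+1 ~ j+2`: then `j+3 ~ j+4`
    left
    obtain ⟨c, hc, -⟩ := hP.perfect (j + 3) n3
    have hcj : c ≠ j := hP.off₂ hc
    have hc4 : c = j + 4 := by
      rcases others j c hcj with rfl | rfl | rfl | rfl
      · exact absurd (huniq hb (hP.symm _ _ hc)) n23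
      · exact absurd (huniq hb' (hP.symm _ _ hc)) n13
      · exact absurd rfl (hP.ne_of_mem hc)
      · rfl
    subst hc4
    have hc' := hP.symm _ _ hc
    ext ⟨x, y⟩
    rw [mem_adjRel₅]
    constructor
    · intro hxy
      have hxj : x ≠ j := hP.off x y hxy
      rcases others j x hxj with rfl | rfl | rfl | rfl
      · exact Or.inl ⟨rfl, huniq hb hxy ▸ rfl⟩
      · exact Or.inr (Or.inl ⟨rfl, huniq hb' hxy ▸ rfl⟩)
      · exact Or.inr (Or.inr (Or.inl ⟨rfl, huniq hc hxy ▸ rfl⟩))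
      · exact Or.inr (Or.inr (Or.inr ⟨rfl, huniq hc' hxy ▸ rfl⟩))
    · rintro (⟨rfl, rfl⟩ | ⟨rfl, rfl⟩ | ⟨rfl, rfl⟩ | ⟨rfl, rfl⟩)
      · exact hb
      · exact hb'
      · exact hc
      · exact hc'
  · -- `j+1 ~ j+3`: the partner of `j+2` is `j+4`, a crossing
    exfalso
    obtain ⟨c, hc, -⟩ := hP.perfect (j + 2) n2
    have hcj : c ≠ j := hP.off₂ hc
    have hc4 : c = j + 4 := by
      rcases others j c hcj with rfl | rfl | rfl | rfl
      · exact absurd (huniq hb (hP.symm _ _ hc)) n23.symm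
      · exact absurd rfl (hP.ne_of_mem hc)
      · exact absurd (huniq hb' (hP.symm _ _ hc)) n12
      · rfl
    subst hc4
    exact hP.planar _ _ _ _ hb hc (hquad j)
  · -- `j+1 ~ j+4`: then `j+2 ~ j+3`
    right
    obtain ⟨c, hc, -⟩ := hP.perfect (j + 2) n2
    have hcj : c ≠ j := hP.off₂ hc
    have hc3 : c = j + 3 := by
      rcases others j c hcj with rfl | rfl | rfl | rfl
      · exact absurd (huniq hb (hP.symm _ _ hc)) n24.symm
      · exact absurd rfl (hP.ne_of_mem hc)
      · rfl
      · exact absurd (huniq hb' (hP.symm _ _ hc)) n12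
    subst hc3
    have hc' := hP.symm _ _ hc
    ext ⟨x, y⟩
    rw [mem_nestRel₅]
    constructor
    · intro hxy
      have hxj : x ≠ j := hP.off x y hxy
      rcases others j x hxj with rfl | rfl | rfl | rfl
      · exact Or.inl ⟨rfl, huniq hb hxy ▸ rfl⟩
      · exact Or.inr (Or.inr (Or.inl ⟨rfl, huniq hc hxy ▸ rfl⟩))
      · exact Or.inr (Or.inr (Or.inr ⟨rfl, huniq hc' hxy ▸ rfl⟩))
      · exact Or.inr (Or.inl ⟨rfl, huniq hb' hxy ▸ rfl⟩)
    · rintro (⟨rfl, rfl⟩ | ⟨rfl, rfl⟩ | ⟨rfl, rfl⟩ | ⟨rfl, rfl⟩)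
      · exact hb
      · exact hb'
      · exact hc
      · exact hc'

/-- the depths of the ten patterns: `(j; adjacent)` is outermost iff `j ∈ {0, 2, 4}`, `(j; nested)` iff `j ∈ {0, 4}`.
[cite: KhristoforovSmirnov2021, §1.2 (arXiv v1 p. 2)] -/
theorem depth_five : ∀ j : Fin 5, (depth j (adjRel₅ j) = 0 ↔ j = 0 ∨ j = 2 ∨ j = 4) ∧ (depth j (nestRel₅ j) = 0 ↔ j = 0 ∨ j = 4) := by
  unfold depth adjRel₅ nestRel₅; decide

/-- the (partner, relation) pairs of the five outermost patterns: `(0; adj), (0; nest), (2; adj), (4; adj), (4; nest)`.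
[cite: KhristoforovSmirnov2021, §1.2 (arXiv v1 p. 2)] -/
def outerPair₅ : Fin 5 → Fin 5 × Finset (Fin 5 × Fin 5) :=
  ![((0 : Fin 5), adjRel₅ 0), ((0 : Fin 5), nestRel₅ 0), ((2 : Fin 5), adjRel₅ 2), ((4 : Fin 5), adjRel₅ 4), ((4 : Fin 5), nestRel₅ 4)]

/-- they are patterns … [cite: KhristoforovSmirnov2021, §1.2 (arXiv v1 p. 2)] -/
theorem isPattern_outerPair₅ (i : Fin 5) : IsPattern (outerPair₅ i).1 (outerPair₅ i).2 := by
  fin_cases i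
  · exact isPattern_adjRel₅ 0
  · exact isPattern_nestRel₅ 0
  · exact isPattern_adjRel₅ 2
  · exact isPattern_adjRel₅ 4
  · exact isPattern_nestRel₅ 4

/-- … of depth zero. [cite: KhristoforovSmirnov2021, §1.2 (arXiv v1 p. 2)] -/
theorem depth_outerPair₅ (i : Fin 5) : depth (outerPair₅ i).1 (outerPair₅ i).2 = 0 := by
  fin_cases i
  · exact ((depth_five 0).1).2 (Or.inl rfl)
  · exact ((depth_five 0).2).2 (Or.inl rfl)
  · exact ((depth_five 2).1).2 (Or.inr (Or.inl rfl))
  · exact ((depth_five 4).1).2 (Or.inr (Or.inr rfl))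
  · exact ((depth_five 4).2).2 (Or.inr rfl)

/-- **the five OUTERMOST patterns of five corners.** [cite: KhristoforovSmirnov2021, §1.2 (arXiv v1 p. 2)] -/
def outer₅ (i : Fin 5) : Pat₀ 5 := ⟨⟨outerPair₅ i, isPattern_outerPair₅ i⟩, depth_outerPair₅ i⟩

/-- `outer₅` is injective (the five tabulated pairs are distinct). [cite: KhristoforovSmirnov2021, §1.2 (arXiv v1 p. 2: link patterns)] -/
theorem outer₅_injective : Function.Injective outer₅ := by
  intro i i' h
  have h' : outerPair₅ i = outerPair₅ i' := congrArg (fun q : Pat₀ 5 => q.1.1) h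
  have key : ∀ i i' : Fin 5, outerPair₅ i = outerPair₅ i' → i = i' := by unfold outerPair₅ adjRel₅ nestRel₅; decide
  exact key i i' h'

/-- ★★ **THE OUTERMOST PATTERNS OF FIVE CORNERS ARE EXACTLY FIVE**: `(0; adj), (0; nest), (2; adj), (4; adj), (4; nest)`.
[cite: KhristoforovSmirnov2021, §1.2 (arXiv v1 p. 2)] -/
theorem pat₀_five (q : Pat₀ 5) : ∃ i : Fin 5, q = outer₅ i := by
  obtain ⟨⟨⟨j, L⟩, hP⟩, h0⟩ := q
  have hP' : IsPattern j L := hP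
  have h0' : depth j L = 0 := h0
  have key : ∃ i : Fin 5, (j, L) = outerPair₅ i := by
    rcases relation_five hP' with rfl | rfl
    · rcases ((depth_five j).1).1 h0' with rfl | rfl | rfl
      · exact ⟨0, rfl⟩
      · exact ⟨2, rfl⟩
      · exact ⟨3, rfl⟩
    · rcases ((depth_five j).2).1 h0' with rfl | rfl
      · exact ⟨1, rfl⟩
      · exact ⟨4, rfl⟩
  obtain ⟨i, hi⟩ := key
  refine ⟨i, Subtype.ext (Subtype.ext ?_)⟩
  exact hi

/-- ★★ hence `#Pat₀ 5 = 5` … [cite: KhristoforovSmirnov2021, §1.2 (arXiv v1 p. 2)] -/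
theorem card_pat₀_five : Fintype.card (Pat₀ 5) = 5 := by
  have hbij : Function.Bijective outer₅ := ⟨outer₅_injective, fun q => by obtain ⟨i, hi⟩ := pat₀_five q; exact ⟨i, hi.symm⟩⟩
  rw [← Fintype.card_congr (Equiv.ofBijective outer₅ hbij), Fintype.card_fin]

/-- ★★★ … **THE TRIPOD LAW AT FIVE MARKS HAS A FIVE-DIMENSIONAL SOLUTION SPACE** (the generic `finrank_solW` evaluated).
[cite: KhristoforovSmirnov2021, §2 Lemma 4, proof and Fig. 3 (p. 4); §1.2 (p. 2)] -/
theorem finrank_solW_five : Module.finrank ℂ (solW 5) = 5 := by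
  rw [finrank_solW, card_pat₀_five]

/-- ★ … and **there are exactly five non-crossing perfect matchings of six points** (the Catalan number `C₃`, via `pat₀EquivNCMatching`).
[cite: KhristoforovSmirnov2021, §1.2 (arXiv v1 p. 2: link patterns)] -/
theorem card_ncMatching_six : Fintype.card (NCMatching 6) = 5 := by
  rw [← card_pat₀_eq_card_ncMatching, card_pat₀_five]

end PatternsFive

/-! ### The five rotated fans are a basis of the solution space -/
section FanBasis

/-- `τ² + τ + 1 = 0`. [folklore] -/
private theorem tau_sum₅' : 1 + tau + tau ^ 2 = 0 := by
  have hprim : IsPrimitiveRoot tau 3 := by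
    have h := Complex.isPrimitiveRoot_exp 3 (by norm_num)
    unfold tau
    convert h using 2
    push_cast
    ring
  have h := hprim.geom_sum_eq_zero (by norm_num : 1 < 3)
  simp only [Finset.sum_range_succ, Finset.sum_range_zero, pow_zero, pow_one, zero_add] at h
  linear_combination h

/-- `τ³ = 1`. [folklore] -/
private theorem tau_cube₅' : tau ^ 3 = 1 := by linear_combination (tau - 1) * tau_sum₅'

/-- powers of the rotation act by addition: `rot^s x = x + s`. [cite: KhristoforovSmirnov2021, §1.2 (arXiv v1 p. 2: cyclic indexing)] -/
theorem rot_pow_apply_five (s x : Fin 5) : (rot 5 ^ s.val) x = x + s := by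
  apply Fin.ext
  rw [val_rot_pow, Fin.val_add]

/-- the image of a relation under a power of the rotation is its translate. [cite: KhristoforovSmirnov2021, §1.2 (arXiv v1 p. 2)] -/
theorem relMap_rot_pow_five (s : Fin 5) (L : Finset (Fin 5 × Fin 5)) :
    relMap (rot 5 ^ s.val) L = L.image fun ab => (ab.1 + s, ab.2 + s) := by
  unfold relMap
  rw [Finset.map_eq_image]
  refine Finset.image_congr fun ab _ => ?_
  show ((rot 5 ^ s.val) ab.1, (rot 5 ^ s.val) ab.2) = (ab.1 + s, ab.2 + s)
  rw [rot_pow_apply_five, rot_pow_apply_five]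

/-- translating the nested pairs seen from `j` gives the nested pairs seen from `j + s`. [cite: KhristoforovSmirnov2021, §1.2 (arXiv v1 p. 2)] -/
theorem nestRel₅_translate (j s : Fin 5) : (nestRel₅ j).image (fun ab => (ab.1 + s, ab.2 + s)) = nestRel₅ (j + s) := by
  revert j s; unfold nestRel₅; decide

/-- **the `s`-th ROTATED FAN** (marks relabelled by `rot^s`), restricted to the patterns of five corners.
[cite: KhristoforovSmirnov2021, §2 Definition 3 (arXiv v1 p. 4); Remark 6 (p. 5)] -/
noncomputable def fanR (s : Fin 5) : Pat 5 → ℂ := restrictW (rotW (rot 5 ^ s.val) (fanWt 2))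

/-- each rotated fan solves the tripod law. [cite: KhristoforovSmirnov2021, §2 Lemma 4 (arXiv v1 p. 4); Remark 6 (p. 5)] -/
theorem fanR_mem_solW (s : Fin 5) : fanR s ∈ solW 5 :=
  tripodLaw_iff_restrict_mem_solW.1 (tripodLaw_rotW_fanWt 2 s.val)

/-- the pattern `(j; nested pairs)`. [cite: KhristoforovSmirnov2021, §1.2 (arXiv v1 p. 2)] -/
def nestPat₅ (j : Fin 5) : Pat 5 := ⟨(j, nestRel₅ j), isPattern_nestRel₅ j⟩

/-- the fan weight on the nested patterns: `−1` at `(0; {1,4},{2,3})` (the rainbow), `−τ⁴` at `(2; {3,1},{4,0})`, zero at the other three.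
[cite: KhristoforovSmirnov2021, §2 Definition 3 (arXiv v1 p. 4)] -/
theorem fanWt_two_nestRel₅ (m : Fin 5) :
    fanWt 2 m (nestRel₅ m) = if m = 0 then -1 else if m = 2 then -tau ^ 4 else 0 := by
  have key : ∀ m : Fin 5, (m.val ≤ 2 ∧ nestRel₅ m = fanRel 2 m.val) ↔ (m = 0 ∨ m = 2) := by
    unfold nestRel₅ fanRel; decide
  unfold fanWt
  by_cases h : m.val ≤ 2 ∧ nestRel₅ m = fanRel 2 m.val
  · rw [if_pos h]
    rcases (key m).1 h with rfl | rfl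
    · simp
    · have h2 : (2 : Fin 5) ≠ 0 := by decide
      rw [if_neg h2, if_pos rfl]
      show -(-tau ^ 2) ^ (2 : ℕ) = -tau ^ 4
      ring
  · rw [if_neg h]
    have hm : ¬ (m = 0 ∨ m = 2) := fun hm => h ((key m).2 hm)
    rw [if_neg (fun e => hm (Or.inl e)), if_neg (fun e => hm (Or.inr e))]

/-- ★ **the rotated fans on the nested patterns**: `fanR s (j; nested) = −1` if `j + s = 0`, `−τ⁴` if `j + s = 2`, else `0` — a
«two-diagonal circulant» evaluation matrix. [cite: KhristoforovSmirnov2021, §2 Definition 3 (arXiv v1 p. 4); Remark 6 (p. 5)] -/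
theorem fanR_nestPat₅ (s j : Fin 5) :
    fanR s (nestPat₅ j) = if j + s = 0 then -1 else if j + s = 2 then -tau ^ 4 else 0 := by
  unfold fanR restrictW rotW nestPat₅
  show fanWt 2 ((rot 5 ^ s.val) j) (relMap (rot 5 ^ s.val) (nestRel₅ j)) = _
  rw [rot_pow_apply_five, relMap_rot_pow_five, nestRel₅_translate, fanWt_two_nestRel₅]

/-- a two-term recurrence `A·g(t+2) + B·g(t) = 0` around `ℤ/5` with `A⁵ + B⁵ ≠ 0` has only the zero solution (step `2` generates `ℤ/5`). [folklore] -/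
private theorem cyclic_elim_five_step_two {A B : ℂ} {g : Fin 5 → ℂ} (h : ∀ t : Fin 5, A * g (t + 2) + B * g t = 0)
    (hAB : A ^ 5 + B ^ 5 ≠ 0) : ∀ t : Fin 5, g t = 0 := by
  intro t
  have h0 := h t
  have h1 := h (t + 2)
  have h2 := h (t + 2 + 2)
  have h3 := h (t + 2 + 2 + 2)
  have h4 := h (t + 2 + 2 + 2 + 2)
  have e5all : ∀ t : Fin 5, t + 2 + 2 + 2 + 2 + 2 = t := by decide
  rw [e5all t] at h4
  have key : (A ^ 5 + B ^ 5) * g t = 0 := by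
    linear_combination B ^ 4 * h0 - A * B ^ 3 * h1 + A ^ 2 * B ^ 2 * h2 - A ^ 3 * B * h3 + A ^ 4 * h4
  exact (mul_eq_zero.1 key).resolve_left hAB

/-- ★★ **THE FIVE ROTATED FANS ARE LINEARLY INDEPENDENT** (evaluate a vanishing combination on the five nested patterns: the coefficients obey
`g(t) + τ⁴ g(t+2) = 0` around `ℤ/5`, and `τ^20 + 1 = −τ ≠ 0`). [cite: KhristoforovSmirnov2021, §2 Definition 3 and Lemma 4 (arXiv v1 p. 4); Remark 6 (p. 5)] -/
theorem linearIndependent_fanR : LinearIndependent ℂ (fun s : Fin 5 => (⟨fanR s, fanR_mem_solW s⟩ : solW 5)) := by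
  rw [Fintype.linearIndependent_iff]
  intro g hg
  -- evaluate the vanishing combination at the nested patterns
  have hfun : ∀ p : Pat 5, ∑ s : Fin 5, g s * fanR s p = 0 := by
    intro p
    have := congrArg (fun w : solW 5 => (w : Pat 5 → ℂ) p) hg
    simpa [Submodule.coe_sum, Finset.sum_apply, Pi.smul_apply, smul_eq_mul] using this
  have hrec : ∀ t : Fin 5, tau ^ 4 * g (t + 2) + 1 * g t = 0 := by
    have fin5 : ∀ t : Fin 5, -t + t = 0 ∧ -t + (t + 2) = 2 ∧ t ≠ t + 2 ∧ (-t + (t + 2) ≠ 0) ∧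
        ∀ s : Fin 5, (-t + s = 0 → s = t) ∧ (-t + s = 2 → s = t + 2) := by decide
    intro t
    obtain ⟨e1, e2, hne, e3, hs⟩ := fin5 t
    have e := hfun (nestPat₅ (-t))
    simp only [fanR_nestPat₅] at e
    rw [Fintype.sum_eq_add t (t + 2) hne (fun s hs' => ?_)] at e
    · rw [if_pos e1, if_neg e3, if_pos e2] at e
      linear_combination -e
    · have hs1 : -t + s ≠ 0 := fun e0 => hs'.1 ((hs s).1 e0)
      have hs2 : -t + s ≠ 2 := fun e0 => hs'.2 ((hs s).2 e0)
      rw [if_neg hs1, if_neg hs2, mul_zero]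
  have hAB : (tau ^ 4) ^ 5 + (1 : ℂ) ^ 5 ≠ 0 := by
    have h3 := tau_cube₅'
    have e : (tau ^ 4) ^ 5 + (1 : ℂ) ^ 5 = -tau := by
      linear_combination (tau ^ 17 + tau ^ 14 + tau ^ 11 + tau ^ 8 + tau ^ 5 + tau ^ 2) * h3 + tau_sum₅'
    rw [e, neg_ne_zero]
    intro h0; rw [h0] at h3; norm_num at h3
  exact cyclic_elim_five_step_two hrec hAB

/-- ★★★ **THE FAN BASIS**: the five rotated fans form a basis of the solution space of the tripod law at five marks.
[cite: KhristoforovSmirnov2021, §2 Definition 3 and Lemma 4 (arXiv v1 p. 4); Remark 6 (p. 5)] -/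
noncomputable def fanBasis : Module.Basis (Fin 5) ℂ (solW 5) :=
  basisOfLinearIndependentOfCardEqFinrank linearIndependent_fanR (by rw [Fintype.card_fin, finrank_solW_five])

/-- the basis vectors are the rotated fans. [cite: KhristoforovSmirnov2021, §2 Definition 3 (arXiv v1 p. 4)] -/
theorem coe_fanBasis (s : Fin 5) : ((fanBasis s : solW 5) : Pat 5 → ℂ) = fanR s := by
  rw [fanBasis, coe_basisOfLinearIndependentOfCardEqFinrank]

/-- ★★★ **EVERY SOLUTION IS A UNIQUE COMBINATION OF THE FIVE ROTATED FANS.** [cite: KhristoforovSmirnov2021, §2 Lemma 4 (arXiv v1 p. 4); Remark 6 (p. 5)] -/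
theorem eq_sum_fanR_of_mem_solW {w : Pat 5 → ℂ} (hw : w ∈ solW 5) : w = ∑ s : Fin 5, fanBasis.repr ⟨w, hw⟩ s • fanR s := by
  have key := fanBasis.sum_repr ⟨w, hw⟩
  have := congrArg (fun v : solW 5 => (v : Pat 5 → ℂ)) key
  simp only [Submodule.coe_sum, Submodule.coe_smul, coe_fanBasis] at this
  exact this.symm

/-- ★★★ **THE TRIPOD LAW AT FIVE MARKS, SOLVED**: a five-disorder class weight obeys the tripod law iff its restriction to the patterns is a
linear combination of the five rotated fans (and then the coefficients are unique).
[cite: KhristoforovSmirnov2021, §2 Definition 3 and Lemma 4 (arXiv v1 p. 4); Remark 6 (p. 5)] -/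
theorem tripodLaw_five_iff_exists_sum_fanR (wt : Fin 5 → Finset (Fin 5 × Fin 5) → ℂ) :
    TripodLaw wt ↔ ∃ g : Fin 5 → ℂ, restrictW wt = ∑ s : Fin 5, g s • fanR s := by
  rw [tripodLaw_iff_restrict_mem_solW]
  constructor
  · intro h
    exact ⟨fun s => fanBasis.repr ⟨restrictW wt, h⟩ s, eq_sum_fanR_of_mem_solW h⟩
  · rintro ⟨g, hg⟩
    rw [hg]
    exact Submodule.sum_mem _ fun s _ => Submodule.smul_mem _ _ (fanR_mem_solW s)

end FanBasis

end Literature.Probability.Percolation.MarkedLoops
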